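import Mathlib
import HarnessLib
import Summits.Ventures.LatticeQCDFlow.Scaling.PlaquetteSharedLinkPeeling
import Summits.Ventures.LatticeQCDFlow.Scaling.PlaquetteManyWeightConstant

/-!
# LatticeQCDFlow / Scaling — peeling ANY number of plaquettes at a shared redrawn link:
# `∫ (∏_{p∈F} w(U_p))·Φ dHaar^{⊗E} ≤ (∫ w^{#F} dHaar)·∫ Φ dHaar^{⊗E}`

HONEST FRAMING: exact (Metropolis-corrected) sampling algorithms for lattice gauge theory;
figures of merit are autocorrelation/cost numbers at stated couplings and volumes; no
continuum-physics claim.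

Venture `LatticeQCDFlow` (cell pub-lqcd), topic `Scaling`, FANOUT row 30 (lean-1, GEN-27) — OUR WORK on
THEORY-2.md §4 row C5, the analytic step of the multi-section peeling (sharper floor of the volume law;
gen26 README «NEXT MATHEMATICS» (4)).  `PlaquetteSharedLinkPeeling` (GEN-26) peeled TWO plaquettes sharing
a freshly drawn link `e` with the two-plaquette constant; `PlaquetteManyWeightConstant` (this generation)
bounds `∫ ∏_{i<n} w(a_i h^{±1} b_i) dHaar ≤ ∫ wⁿ dHaar` for any `n`.  Here the two are combined:

* §1 **`exists_plaquetteHolonomy_update_eq_bool`** — the normal form of `PlaquetteSharedLinkPeeling` §1 with a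
  Boolean flag: `U[e ↦ v]_p = A·v^{[ε]}·B`;
* §2 **`integral_update_prod_plaquettes_le`** — for a non-empty finite set `F` of plaquettes all containing
  the link `e`, `∫ ∏_{p∈F} w(U[e ↦ v]_p) dHaar(v) ≤ ∫ w^{#F} dHaar` for every configuration `U`;
* §3 **`integral_prod_weight_mul_le_pow`** — THE FUBINI STEP: for `Φ ≥ 0` bounded measurable and blind to `e`,
  `∫ (∏_{p∈F} w(U_p))·Φ(U) dHaar^{⊗E} ≤ (∫ w^{#F} dHaar)·∫ Φ dHaar^{⊗E}` — one heat-bath draw that closes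
  `#F − 1` further plaquettes besides its own is worth the many-plaquette constant `c_{#F} = ∫ w^{#F}`,
  not `c·M^{#F−1}`.

No `def`, no `sorry`, nothing cited as a fact beyond the tree.
-/

noncomputable section

namespace Summit.Ventures.LatticeQCDFlow.Theory2.Autoregressive

open MeasureTheory Function Finset
open Literature.MathematicalPhysics.QuantumFieldTheory Literature.MathematicalPhysics.QuantumLattice
open Summit.Ventures.LatticeQCDFlow.Exactness

variable {d L : ℕ} [NeZero L] {G : Type*} [Group G] [TopologicalSpace G] [IsTopologicalGroup G]
  [CompactSpace G] [SecondCountableTopology G] [MeasurableSpace G] [BorelSpace G]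

/-! ## §1 Normal form with a Boolean flag -/

omit [TopologicalSpace G] [IsTopologicalGroup G] [CompactSpace G] [SecondCountableTopology G]
  [MeasurableSpace G] [BorelSpace G] in
/-- For each link `e` of `p = (x; i, j)` (`i ≠ j`, `L ≥ 2`) there are `A, B ∈ G` and a flag `ε` with
`U[e ↦ v]_p = A·(v if ε else v⁻¹)·B` for all `v`. [ours] -/
theorem exists_plaquetteHolonomy_update_eq_bool (hL : 2 ≤ L) (U : GaugeConfig d L G) (x : Site d L)
    {i j : Fin d} (hij : i ≠ j) {e : Edge d L}
    (he : e ∈ ({(x, i), (x.shift i, j), (x.shift j, i), (x, j)} : Finset (Edge d L))) :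
    ∃ (A B : G) (ε : Bool), ∀ v, plaquetteHolonomy (update U e v) x i j = A * (if ε then v else v⁻¹) * B := by
  obtain ⟨A, B, h⟩ := exists_plaquetteHolonomy_update_eq hL U x hij he
  rcases h with h | h
  · exact ⟨A, B, true, fun v => by rw [h v]; simp⟩
  · exact ⟨A, B, false, fun v => by rw [h v]; simp⟩

/-! ## §2 Any number of plaquettes sharing the redrawn link -/

omit [SecondCountableTopology G] in
/-- **`∫ ∏_{p∈F} w(U[e ↦ v]_p) dHaar(v) ≤ ∫ w^{#F} dHaar`** for a non-empty finite set `F` of plaquettes all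
containing `e` (`L ≥ 2`, `w ≥ 0` continuous): the normal forms `A_p v^{[ε_p]} B_p` and
`PlaquetteManyWeightConstant.integral_prod_shiftedWeight_le`. [ours] -/
theorem integral_update_prod_plaquettes_le (hL : 2 ≤ L) {w : G → ℝ} (hw : Continuous w) (hw0 : ∀ g, 0 ≤ w g)
    (U : GaugeConfig d L G) {e : Edge d L} (F : Finset (Plaquette d L)) (hF : F.Nonempty)
    (heF : ∀ p ∈ F, e ∈ ({(p.1, p.2.1.1), (p.1.shift p.2.1.1, p.2.1.2),
        (p.1.shift p.2.1.2, p.2.1.1), (p.1, p.2.1.2)} : Finset (Edge d L))) :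
    ∫ v, ∏ p ∈ F, w (plaquetteHolonomy (update U e v) p.1 p.2.1.1 p.2.1.2) ∂(haarProbability G) ≤
      ∫ h, w h ^ F.card ∂(haarProbability G) := by
  classical
  have hnf : ∀ p : Plaquette d L, ∃ (A B : G) (ε : Bool), p ∈ F →
      ∀ v, plaquetteHolonomy (update U e v) p.1 p.2.1.1 p.2.1.2 = A * (if ε then v else v⁻¹) * B := by
    intro p
    by_cases hp : p ∈ F
    · obtain ⟨A, B, ε, h⟩ := exists_plaquetteHolonomy_update_eq_bool hL U p.1 (ne_of_lt p.2.2) (heF p hp)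
      exact ⟨A, B, ε, fun _ => h⟩
    · exact ⟨1, 1, true, fun h => absurd h hp⟩
  choose A B ε hABε using hnf
  have hrw : ∀ v, ∏ p ∈ F, w (plaquetteHolonomy (update U e v) p.1 p.2.1.1 p.2.1.2) =
      ∏ p ∈ F, w (A p * (if ε p then v else v⁻¹) * B p) := fun v =>
    Finset.prod_congr rfl fun p hp => by rw [hABε p hp v]
  simp_rw [hrw]
  exact integral_prod_shiftedWeight_le hw hw0 F hF A B ε

/-! ## §3 The Fubini step -/

/-- **Peeling any number of plaquettes at a shared link.**  `L ≥ 2`; `F` a non-empty finite set of plaquettes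
all containing the link `e`; `w > 0` continuous with `w ≤ M`; `Φ ≥ 0` bounded measurable and blind to `e`.  Then
`∫ (∏_{p∈F} w(U_p))·Φ(U) dHaar^{⊗E} ≤ (∫ w^{#F} dHaar)·∫ Φ dHaar^{⊗E}`. [ours] -/
theorem integral_prod_weight_mul_le_pow (hL : 2 ≤ L) {e : Edge d L} (F : Finset (Plaquette d L))
    (hF : F.Nonempty)
    (heF : ∀ p ∈ F, e ∈ ({(p.1, p.2.1.1), (p.1.shift p.2.1.1, p.2.1.2),
        (p.1.shift p.2.1.2, p.2.1.1), (p.1, p.2.1.2)} : Finset (Edge d L)))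
    {w : G → ℝ} (hw : Continuous w) (hw0 : ∀ g, 0 < w g) {M : ℝ} (hM : ∀ g, w g ≤ M)
    {Φ : GaugeConfig d L G → ℝ} (hΦm : Measurable Φ) {C' : ℝ} (hΦb : ∀ U, |Φ U| ≤ C')
    (hΦ0 : ∀ U, 0 ≤ Φ U) (hΦe : ∀ U v, Φ (update U e v) = Φ U) :
    ∫ U, (∏ p ∈ F, w (plaquetteHolonomy U p.1 p.2.1.1 p.2.1.2)) * Φ U
        ∂Measure.pi (fun _ : Edge d L => haarProbability G) ≤
      (∫ h, w h ^ F.card ∂(haarProbability G)) *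
        ∫ U, Φ U ∂Measure.pi (fun _ : Edge d L => haarProbability G) := by
  set μ := haarProbability G with hμ
  have huniv : (fun _ : Edge d L => μ) e Set.univ ≠ 0 := by simp [hμ]
  have hMpos : 0 < M := (hw0 1).trans_le (hM 1)
  have hC' : 0 ≤ C' := (abs_nonneg _).trans (hΦb 1)
  have hwm : Measurable w := hw.measurable
  have hPm : Measurable fun U : GaugeConfig d L G => ∏ p ∈ F, w (plaquetteHolonomy U p.1 p.2.1.1 p.2.1.2) :=
    Finset.measurable_prod F fun p _ => hwm.comp (measurable_plaquetteHolonomy p.1 p.2.1.1 p.2.1.2)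
  have hPpos : ∀ U : GaugeConfig d L G, 0 < ∏ p ∈ F, w (plaquetteHolonomy U p.1 p.2.1.1 p.2.1.2) :=
    fun U => prod_pos fun p _ => hw0 _
  have hPb : ∀ U : GaugeConfig d L G, ∏ p ∈ F, w (plaquetteHolonomy U p.1 p.2.1.1 p.2.1.2) ≤ M ^ F.card := by
    intro U
    rw [← Finset.prod_const]
    exact Finset.prod_le_prod (fun p _ => (hw0 _).le) fun p _ => hM _
  have hFm : Measurable fun U : GaugeConfig d L G =>
      (∏ p ∈ F, w (plaquetteHolonomy U p.1 p.2.1.1 p.2.1.2)) * Φ U := hPm.mul hΦm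
  have hFi : Integrable (fun U : GaugeConfig d L G =>
      (∏ p ∈ F, w (plaquetteHolonomy U p.1 p.2.1.1 p.2.1.2)) * Φ U) (Measure.pi fun _ : Edge d L => μ) := by
    refine Integrable.mono' (integrable_const (M ^ F.card * C')) hFm.aestronglyMeasurable
      (ae_of_all _ fun U => ?_)
    rw [Real.norm_eq_abs, abs_mul, abs_of_pos (hPpos U)]
    exact mul_le_mul (hPb U) (hΦb _) (abs_nonneg _) (pow_nonneg hMpos.le _)
  have hΦi : Integrable Φ (Measure.pi fun _ : Edge d L => μ) :=
    Integrable.mono' (integrable_const C') hΦm.aestronglyMeasurable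
      (ae_of_all _ fun U => by rw [Real.norm_eq_abs]; exact hΦb U)
  rw [integral_pi_eq_integral_integral_update' (fun _ : Edge d L => μ) e huniv hFi]
  simp only [measure_univ, inv_one, ENNReal.toReal_one, one_smul]
  have hinner : ∀ U : GaugeConfig d L G,
      ∫ v, (∏ p ∈ F, w (plaquetteHolonomy (update U e v) p.1 p.2.1.1 p.2.1.2)) * Φ (update U e v) ∂μ ≤
        (∫ h, w h ^ F.card ∂μ) * Φ U := by
    intro U
    simp only [hΦe]
    rw [integral_mul_const]
    exact mul_le_mul_of_nonneg_right
      (integral_update_prod_plaquettes_le hL hw (fun g => (hw0 g).le) U F hF heF) (hΦ0 U)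
  calc ∫ U, ∫ v, (∏ p ∈ F, w (plaquetteHolonomy (update U e v) p.1 p.2.1.1 p.2.1.2)) * Φ (update U e v) ∂μ
          ∂Measure.pi (fun _ : Edge d L => μ)
      ≤ ∫ U, (∫ h, w h ^ F.card ∂μ) * Φ U ∂Measure.pi (fun _ : Edge d L => μ) :=
        integral_mono_of_nonneg
          (ae_of_all _ fun U => integral_nonneg fun v => mul_nonneg (hPpos _).le (hΦ0 _))
          (hΦi.const_mul _) (ae_of_all _ hinner)
    _ = (∫ h, w h ^ F.card ∂μ) * ∫ U, Φ U ∂Measure.pi (fun _ : Edge d L => μ) := integral_const_mul _ _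

end Summit.Ventures.LatticeQCDFlow.Theory2.Autoregressive

end
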